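import Literature.AnabelianGeometry.EtaleTheta.ConstantMultipleIndeterminacy
import Literature.AnabelianGeometry.EtaleTheta.Discharge.Sec5AutAmple
import HarnessLib

/-!
# [EtTh] Corollary 5.12, proof of (i)/(ii): the divisor-level content of "the pull-back … is isomorphic to
# the `M`-th tensor power" — PROVED over the abstract §5 data (sub-DAG row C512-L01)

Mochizuki, *The étale theta function and its Frobenioid-theoretic manifestations*, Publ. RIMS **45** (2009),
Corollary 5.12 (p.339 (PDF p.113)) and its proof (p.340 l.−8 – p.341 l.2 (PDF pp.114–115)):
"Since `β_{N,N'}` is an isometry of Frobenius degree `M`, it follows that the pull-back via the morphism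
`B^bs_{N'} → B^bs_N` of `D` of the line bundle that determines the object `B_N` is isomorphic to the `M`-th tensor
power of the line bundle that determines the object `B_{N'}`."  [cite: MochizukiEtTh2009, Cor 5.12 proof p.340 (PDF p.114)]

Cell abc-iut, layer L2, SUBDAG-WANTED (L2) §K row **K7** (seat abc-iut-w5-d238; sub-DAG file
`plan/L2/SUBDAG-EtTh-Cor512.md`, row C512-L01).  PROOF-ONLY companion of abc-iut-L2-t4's
`ConstantMultipleIndeterminacy.lean` (data `ConstantMultiple.RootMorphismData`): no definition, no named fact.

Over the ABSTRACT §5 data (`ThetaFrobenioid` = the tree's `PreFrobenioidData` + §5 extras) the objects of `C`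
carry no "line bundle"; what the Frobenioid structure does see of the quoted sentence is its ZERO-DIVISOR form,
obtained by applying `Div` ([FrdI] Rmk 1.1.1: `Div(φ ∘ ψ) = Base(ψ)^* Div(φ) + deg_Fr(φ)·Div(ψ)`) to the two
commutative squares `s^⊓_{N'} ; β = α ; s^⊓_N`, `s^⊔_{N'} ; β = α ; s^⊔_N` of Corollary 5.12, using that `α`,
`β` are isometries (`Div = 0`) of Frobenius degree `M = N'/N`:

* `RootMorphismData.div_sCap'_pow_degFr_eq` / `div_sCup'_pow_degFr_eq` —
  `Div(s^⊓_{N'})^{deg_Fr β} = (α^bs)^* Div(s^⊓_N)` in `Φ(A^bs_{N'})` (multiplicative notation of the tree), and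
  the same for `⊔`: the divisor of the `N'`-th-root section to the `M`-th power is the pull-back along `α^bs`
  of the divisor of the `N`-th-root section — i.e. "`(α^bs)^*(line bundle of B_N) ≅ (line bundle of B_{N'})^{⊗M}`"
  read on zero divisors of the defining sections (the objects `A_N`, `A_{N'}` being Frobenius-trivial);
* `RootMorphismData.degFr_α_eq_degFr_β`, `degFr_β_mul_N`, `div_sCap'_pow_quot_eq` — `deg_Fr α = deg_Fr β = M`
  with `M·N = N'`, and the same identity with the exponent written as `N'/N`;
* (sub-DAG row C512-r13, [EtTh] Rmk. 5.12.5 (iii) p.345 (PDF p.119)) `ThetaFrobenioid.autExtensionExact_iff_isAutAmple`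
  — abc-iut-L2-t4's named statement `AutExtensionExact 𝔉 S` (exactness of
  `1 → O^×(S) → Aut_C(S) → Aut_D(S^bs) → 1`) is EQUIVALENT to Aut-ampleness of `S` ([FrdI] Def. 1.2 (iv)), its left
  half being L2-t4's PROVED `units_eq_ker`; hence `autExtensionExact_BN_of_sgpCapSection` /
  `autExtensionExact_BN_of_autAmpleBN`: it HOLDS at `B_N` from the section `s^⊓-gp_N` (p.331 (PDF p.105)), exactly
  print's "objects … which are Aut-ample — cf. the discussion preceding Lemma 5.8".

What is NOT here (rows C512-L02/L03 of the sub-DAG, MODEL inputs of the printed proof): "all positive tensor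
powers of these line bundles are nontrivial" and "the isomorphism classes of these line bundles are preserved by
arbitrary automorphisms of `B^bs`" ([EtTh] §1, discussion preceding Prop. 1.1) — statements about the tempered
Frobenioid of `Ÿ` that the abstract interface cannot express; hence Cor. 5.12 (i) `IsoClassesDistinct` and
(ii) `ExistsLinearIota` stay the named statements of record (abc-iut-L2-t4), and (iii) is L2-t4's theorem
`constantMultipleIndeterminacy_of` from (i).  HONEST FRAMING: classical bookkeeping inside a published,
refereed paper; nothing here bears on [IUTchIII] Cor. 3.12; typed ≠ proved except the theorems below.
-/

namespace Literature.AnabelianGeometry.EtaleTheta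

open CategoryTheory

universe w v v' u u'

namespace ConstantMultiple

namespace RootMorphismData

variable {C : Type u} [Category.{v} C] {D : Type u'} [Category.{v'} D]
variable {𝔉 : ThetaFrobenioid.{w} C D} {V : FrobenioidThetaBiKummer.BiKummerVocabStub 𝔉}
  (R : RootMorphismData 𝔉 V)

/-- **`deg_Fr(β_{N,N'}) · N = N'`** (the field `degFr_β`, restated with the tree's `ℕ+` coercions unfolded:
"`β_{N,N'}` is an isometry of Frobenius degree `M`", `M = N'/N`, Cor. 5.12 p.339 (PDF p.113)).
[cite: MochizukiEtTh2009, Cor 5.12 p.339 (PDF p.113)] -/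
theorem degFr_β_mul_N : (𝔉.degFr R.β : ℕ) * (𝔉.N : ℕ) = (R.N' : ℕ) := R.degFr_β

/-- **`deg_Fr(α_{N,N'}) = deg_Fr(β_{N,N'})`** (both are "of Frobenius degree `M`", Cor. 5.12 p.339
(PDF p.113)): from `deg_Fr(α)·N = N' = deg_Fr(β)·N`.  [cite: MochizukiEtTh2009, Cor 5.12 p.339 (PDF p.113)] -/
theorem degFr_α_eq_degFr_β : 𝔉.degFr R.α = 𝔉.degFr R.β := by
  have h : (𝔉.degFr R.α : ℕ) * (𝔉.N : ℕ) = (𝔉.degFr R.β : ℕ) * (𝔉.N : ℕ) := by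
    rw [R.degFr_α, R.degFr_β]
  exact PNat.eq (Nat.eq_of_mul_eq_mul_right 𝔉.N.pos h)

/-- **`deg_Fr(β_{N,N'}) = N'/N`** as natural numbers (`M := N'/N`, Cor. 5.12 p.339 (PDF p.113)).
[cite: MochizukiEtTh2009, Cor 5.12 p.339 (PDF p.113)] -/
theorem degFr_β_eq_quot : (𝔉.degFr R.β : ℕ) = (R.N' : ℕ) / (𝔉.N : ℕ) := by
  rw [← R.degFr_β, Nat.mul_div_cancel _ 𝔉.N.pos]

/-- **The divisor form of "`(B^bs_{N'} → B^bs_N)^*`(line bundle of `B_N`) `≅` (line bundle of `B_{N'}`)`^{⊗M}`"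
for the `⊓`-root** (Cor. 5.12 proof, p.340 (PDF p.114)): applying `Div` ([FrdI] Rmk 1.1.1) to the commutative
square `s^⊓_{N'} ; β_{N,N'} = α_{N,N'} ; s^⊓_N`, with `Div(α) = Div(β) = 0` (isometries), gives
`Div(s^⊓_{N'})^{deg_Fr β} = (α^bs)^* Div(s^⊓_N)` in `Φ(A^bs_{N'})`.
[cite: MochizukiEtTh2009, Cor 5.12 proof p.340 (PDF p.114)] -/
theorem div_sCap'_pow_degFr_eq :
    𝔉.pre.div R.sCap' ^ (𝔉.degFr R.β : ℕ) = 𝔉.pre.pull (𝔉.base.map R.α) (𝔉.pre.div 𝔉.sCap) := by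
  have hβ : 𝔉.pre.div R.β = 1 := R.isIsometry_β
  have hα : 𝔉.pre.div R.α = 1 := R.isIsometry_α
  have h := congrArg 𝔉.pre.div R.comm_sCap
  rw [𝔉.pre.div_comp, 𝔉.pre.div_comp, hβ, hα, map_one, one_mul, one_pow, mul_one] at h
  exact h

/-- The same for the `⊔`-root: `Div(s^⊔_{N'})^{deg_Fr β} = (α^bs)^* Div(s^⊔_N)` (Cor. 5.12 proof, p.340
(PDF p.114), second commutative square).  [cite: MochizukiEtTh2009, Cor 5.12 proof p.340 (PDF p.114)] -/
theorem div_sCup'_pow_degFr_eq :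
    𝔉.pre.div R.sCup' ^ (𝔉.degFr R.β : ℕ) = 𝔉.pre.pull (𝔉.base.map R.α) (𝔉.pre.div 𝔉.sCup) := by
  have hβ : 𝔉.pre.div R.β = 1 := R.isIsometry_β
  have hα : 𝔉.pre.div R.α = 1 := R.isIsometry_α
  have h := congrArg 𝔉.pre.div R.comm_sCup
  rw [𝔉.pre.div_comp, 𝔉.pre.div_comp, hβ, hα, map_one, one_mul, one_pow, mul_one] at h
  exact h

/-- **"… isomorphic to the `M`-th tensor power", `M = N'/N`** (Cor. 5.12 proof, p.340 (PDF p.114)): the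
`⊓`-identity with the exponent written as the quotient `N'/N`.
[cite: MochizukiEtTh2009, Cor 5.12 proof p.340 (PDF p.114)] -/
theorem div_sCap'_pow_quot_eq :
    𝔉.pre.div R.sCap' ^ ((R.N' : ℕ) / (𝔉.N : ℕ)) = 𝔉.pre.pull (𝔉.base.map R.α) (𝔉.pre.div 𝔉.sCap) := by
  rw [← R.degFr_β_eq_quot]
  exact R.div_sCap'_pow_degFr_eq

/-- The `⊔`-identity with the exponent `N'/N`.  [cite: MochizukiEtTh2009, Cor 5.12 proof p.340 (PDF p.114)] -/
theorem div_sCup'_pow_quot_eq :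
    𝔉.pre.div R.sCup' ^ ((R.N' : ℕ) / (𝔉.N : ℕ)) = 𝔉.pre.pull (𝔉.base.map R.α) (𝔉.pre.div 𝔉.sCup) := by
  rw [← R.degFr_β_eq_quot]
  exact R.div_sCup'_pow_degFr_eq

/-- **The exponent is at least `2`** ("`M = N'/N ≠ 1`", Cor. 5.12 p.339 (PDF p.113)): `2 ≤ deg_Fr(β_{N,N'})` — so the
identities above relate the `N`-th-root divisor to a GENUINE power (`≥ 2`) of the `N'`-th-root divisor, which is
what makes "all positive tensor powers … are nontrivial" (§1) bite in the printed proof of (i).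
[cite: MochizukiEtTh2009, Cor 5.12 p.339 (PDF p.113)] -/
theorem two_le_degFr_β : 2 ≤ (𝔉.degFr R.β : ℕ) := by
  have hpos : 1 ≤ (𝔉.degFr R.β : ℕ) := (𝔉.degFr R.β).pos
  rcases Nat.lt_or_ge 1 (𝔉.degFr R.β : ℕ) with h | h
  · exact h
  · exfalso
    have h1 : (𝔉.degFr R.β : ℕ) = 1 := le_antisymm h hpos
    have hN : (𝔉.N : ℕ) = (R.N' : ℕ) := by
      have := R.degFr_β
      rw [h1, one_mul] at this
      exact this
    exact R.ne (PNat.eq hN)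

end RootMorphismData

end ConstantMultiple

/-! ### [EtTh] Remark 5.12.5 (iii): the exact sequence `1 → O^×(−) → Aut_C((−)) → Aut_D((−)^bs) → 1` -/

namespace ThetaFrobenioid

variable {C : Type u} [Category.{v} C] {D : Type u'} [Category.{v'} D] (𝔉 : ThetaFrobenioid.{w} C D)

/-- **Rmk. 5.12.5 (iii) exactness ⟺ surjectivity of `Aut_C(S) → Aut_D(S^bs)`**: the left half
`O^×(S) = Ker` is abc-iut-L2-t4's PROVED `units_eq_ker` ([FrdI] Def. 1.2 (ii)), so the named statement
`AutExtensionExact 𝔉 S` carries exactly the surjectivity ("for objects … which are Aut-ample", p.345 (PDF p.119)).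
[cite: MochizukiEtTh2009, Rmk 5.12.5 (iii) p.345 (PDF p.119)] -/
theorem autExtensionExact_iff_surjective (S : C) :
    AutExtensionExact 𝔉 S ↔ Function.Surjective (𝔉.autBase S) :=
  ⟨fun h => h.2, fun h => ⟨𝔉.units_eq_ker S, h⟩⟩

/-- **Rmk. 5.12.5 (iii) exactness ⟺ `S` is Aut-ample** ([FrdI] Def. 1.2 (iv): every automorphism of `S^bs`
lifts to `Aut_C(S)`; the tree's `PreFrobenioidData.IsAutAmple`).  [cite: MochizukiEtTh2009, Rmk 5.12.5 (iii) p.345 (PDF p.119)] -/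
theorem autExtensionExact_iff_isAutAmple (S : C) : AutExtensionExact 𝔉 S ↔ 𝔉.IsAutAmple S := by
  rw [𝔉.autExtensionExact_iff_surjective]
  constructor
  · intro h β
    obtain ⟨α, hα⟩ := h β
    exact ⟨α, hα⟩
  · intro h β
    obtain ⟨α, hα⟩ := h β
    exact ⟨α, hα⟩

/-- **The exact sequence of Rmk. 5.12.5 (iii) HOLDS at `B_N`** as soon as `s^⊓-gp_N` is a section of
`Aut_C(B_N) → Aut_D(B_N^bs)` (p.331 (PDF p.105); abc-iut-L2-t4's `SgpCapSection`): "objects `(−)`, such as … `B_N`,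
which are Aut-ample — cf. the discussion preceding Lemma 5.8" (p.345 (PDF p.119)).
[cite: MochizukiEtTh2009, Rmk 5.12.5 (iii) p.345 (PDF p.119)] -/
theorem autExtensionExact_BN_of_sgpCapSection (hsec : 𝔉.SgpCapSection) : AutExtensionExact 𝔉 𝔉.BN :=
  ⟨𝔉.units_eq_ker 𝔉.BN, fun g => ⟨𝔉.sgpCap g, hsec g⟩⟩

/-- The same from abc-iut-L2-t4's named Aut-ampleness of `B_N` (`AutAmpleBN`, Lemma 5.8 setting;
`Discharge/Sec5AutAmple.lean` derives it from `SgpCapSection`).  [cite: MochizukiEtTh2009, Rmk 5.12.5 (iii) p.345 (PDF p.119)] -/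
theorem autExtensionExact_BN_of_autAmpleBN (h : 𝔉.AutAmpleBN) : AutExtensionExact 𝔉 𝔉.BN :=
  ⟨𝔉.units_eq_ker 𝔉.BN, h⟩

end ThetaFrobenioid

end Literature.AnabelianGeometry.EtaleTheta
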